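import Literature.MathematicalPhysics.QuantumFieldTheory.Balaban1983to89.Node00.Record13SepCoPHV
import Literature.MathematicalPhysics.QuantumFieldTheory.Balaban1983to89.Node00.Record13CoPHChi

/-!
# NODE 00 — [Ax-3d] of WORK ORDER RC-1 (director-ym №467 (ii) «L-gen … add-and-reglue»; CRIT-1 g33 RULING Q-3 (iii)): the SEPARATED-RANGE (SepCoPH) provisos ∕ tower ∕
# datum ∕ record predicate of `Node00/Record13SepCoPH` §11–§11b and the VERSION SLOT of `Node00/Record13SepCoPHV` §2 RE-ISSUED GENERIC IN THE β-SLOT χ —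
# `PartCompat₁₃Chi`, `suppOfRecord₁₃PChi`, `suppOfRecord₁₃SepCoPChi`, `Stage13HParams.Provisos₁₃SepCoPHChi` (+ `.toCore ∕ .wtLaws ∕ .tstep …`), `towerOfRecord₁₃SepCoPHChi`,
# `datumOfRecord₁₃SepCoPHChi` + faces, `IsRecordOfRecord₁₃CSepCoPHChi`, `Revision₁₃Chi`, `towerOfRecord₁₃SepCoPHVChi`, `datumOfRecord₁₃SepCoPHVChi` + the face family —
# receipts at `χ := chiβOfRecord₁₃ θ`, and THE Ax INSTANCES director-ym №467 (ii) names: `Provisos₁₃SepCoPHAx`, `datumOfRecord₁₃SepCoPHAx`, `Revision₁₃Ax`,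
# `datumOfRecord₁₃SepCoPHVAx` with `(datumOfRecord₁₃SepCoPHVAx θ h v).βfun = betaOfRecord₁₃Ax θ` (`rfl`), `isDatumOfRecord₀_datumOfRecord₁₃SepCoPHVAx` (`rfl`),
# `endpointExistence_datumOfRecord₁₃SepCoPHVAx_iff` (`Iff.rfl`)

CITATION HEADER.  [I] = [Balaban1987RG1] (CMP **109**) (0.19) p.255, (1.20)–(1.22) p.264, Thm 2 p.259; [III] = [Balaban1988Convergent] (2.1) p.254, (2.18) p.257, (2.28) p.259,
Thm 1 p.262, (3.25) p.270; [V] = [Balaban1989LargeFieldII] Thm 1 + (0.1) pp.355–356.  Every declaration of §G below is the VERBATIM body of the like-named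
declaration of `Node00/Record13.lean` (1251–1262), `Node00/Record13CoP.lean` (86–89), `Node00/Record13SepCoP.lean` (52–72), `Node00/Record13SepCoPH.lean` (64–183,
240–460) and `Node00/Record13SepCoPHV.lean` (179–328) with EXACTLY the substitutions of `Node00/Record13Chi` ∕ `Node00/Record13CoPHChi` (binder `(χ : ChiSlot F N)`
after `θ`; centre-reading names `X ↦ XChi … χ`; `chiβOfRecord₁₃ … ↦ χ`; row lemmas `↦ …_chi`; the `zetaMeas` autoParam default dropped).  NOTHING of record is
edited (body-freeze №460 (2)); hands: porter PT-A-2 (`ymgap-nodeO-port-PTA-2`); custodians node00 def-Y∕def-T∕K0e.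
HONEST FRAMING.  Definitions re-issued over a parameter + receipts + instances; provisos stay HYPOTHESES; nothing of Bałaban's asserted, ported or
discharged; K0⁷∕K1⁹∕K3⁸ AS VETTED read the choice-centred cut-off — the Ax instances are the carriers the re-cuts K0ᴬ∕K1ᴬ∕K3ᴬ∕27930⁸ will read;
no `sorry`∕`instance`∕`notation`; standard axioms; the YM mass gap (Clay) is NOT proved by any of this.
-/

noncomputable section

open MeasureTheory
open scoped Matrix.Norms.L2Operator

namespace Literature.MathematicalPhysics.QuantumFieldTheory.Balaban1983to89.Node00

open T4Continuum AveragingRT T4FiniteEpsInhabited FlowStep FlowStepRuns DagBinding T4DatumAssembly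
open B12Eq019ActionBody (integrand)

variable (F : T4Family) (N : ℕ) [NeZero N]

/-! ## §G. THE χ-GENERIC RE-ISSUE (verbatim bodies) -/

/-- **COMPATIBILITY OF THE 𝐃_j-PARTITIONS OF RECORD WITH THE TORUS along a run, up to length `n`** (v1.2; plan g67 WORD-T2 = K0a 11b's located
clause (C2) `hC2` VERBATIM at `(p, n)`, `Node00/Record13InhabitedOfThm1C`): at every scale `1 ≤ j ≤ n` the side `L^j·M·R_j(g_j)` (in fine sites) of the
𝐃_j-cubes of record (`dCubeSide`, `RkOfRecord` = (2.5)) DIVIDES the torus period — [III] p. 257 «we assume that all partitions are compatible».  A RANGE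
RESTRICTION ON RUNS `(p, n)`, of the same kind as the window `Step.InInterval`, displayed as the second antecedent of row P11 `bg`: true along print's runs
(the renormalisation condition ties `g₀` to `K`), false as a θ-level ∀-sentence (at fixed `(K, m)` a windowed history with `g_j → 0` has `R_j = L^{s_j}`
beyond the torus — K0a's located numbers), hence neither a proviso ROW nor an admissibility clause. [cite: Balaban1988Convergent, (2.1) p.254, (2.5) p.255, p.257] -/
def PartCompat₁₃Chi (θ : Stage13Params F N) (χ : ChiSlot F N) (p : B12.RunParams) (n : ℕ) : Prop :=
  ∀ j, 1 ≤ j → j ≤ n → dCubeSide (F.P p.K).L θ.τ9.M (RkOfRecord (F.P p.K).L θ.ν.r (gOfRecord₁₃Chi F N θ χ p j)) j ∣ (F.P p.K).sitesPerDir 0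

/-- Length `0`: no scale to check (vacuous). [cite: Balaban1988Convergent, p.257 (bookkeeping)] -/
theorem partCompat₁₃_zero_chi (θ : Stage13Params F N) (χ : ChiSlot F N) (p : B12.RunParams) : PartCompat₁₃Chi F N θ χ p 0 :=
  fun _ h1 hj => absurd (le_trans h1 hj) (Nat.not_succ_le_zero 0)
/-- **THE SUPPORT OF RECORD** of the background proviso, Stage 13 (def-R's `regSuppPOfRecord` at `cR` along the ₁₃ history). [cite: Balaban1988Convergent, (2.10) p.256, (2.28) p.259] -/
def suppOfRecord₁₃PChi (θ : Stage13Params F N) (χ : ChiSlot F N) (p : B12.RunParams) (n : ℕ) :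
    SeqOfRecord F θ.ν θ.τ9.M (gOfRecord₁₃Chi F N θ χ p) p.K n → Set (B15DeterminingSets.MSField (F.P p.K) (SU N)) :=
  regSuppPOfRecord F N θ.ν θ.τ9.M (gOfRecord₁₃Chi F N θ χ p) p.K n θ.s2.cR
/-- **THE SUPPORT OF ROW P11 ON PRINT'S SEQUENCES AND PRINT'S DATA** (v1.4 = v1.3's support WITHOUT the (1.9) guard — director-ym №149 (5): (1.9) is a property of the row's background `UbgOfRecord₁₃CoPChi`, def-R `coDivClassOn_UbgMSCoPOfRecord`; v1.3: node00-def-P11 LOCATED-P11-MIXED-SUPPORT, director-ym №141∕№142,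
dag-lead DEDUP-257, plan g67 ρ1): §9's separated support `suppOfRecord₁₃SepP` CUT DOWN ONCE MORE to the data `W` that are REGULAR IN PRINT'S SENSE
[15] (7) p. 278 — on every plaquette `p′` touching `Λ_{m+1}` the MIXED plaquette variable built with the `V ∕ V̄` rule (bonds off `Λ_{m+1}` carry the
one-step average of the finer datum) is within `c_R·ε_{m+1}` of `1` (node00-def-P11's `Sect2.DataSmall7P`, the Literature-side twin of print's clause,
on PRINT'S RANGE `Sect2.printedPlaqs` = the level-`j` plaquettes touching `Γ_j` none of whose four bonds has both endpoints in `Ω_{j+1}` — HYP-AUDIT-13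
H6 CONCORD node00-def-P11 × dag-ref-G × dag-ref-C: level 0 keeps every all-bonds-pinned plaquette, levels ≥ 1 read `W (m+1)` on `Λ`-bonds and `V̄` on outer
bonds and never a bond inside `Ω_{m+2}`, where print defines nothing; [III] p. 256 «we assume that the field V_{j−1} is
regular on Γ_{j−1}» read with [15]'s convention).  Membership = `⟨regular support, separation,
(7)-regularity⟩`, in this order.  A SUPPORT GUARD of the same (T1)-shape as v1.2's: a proviso over it demands nothing at data print excludes.
[cite: Balaban1985RegularSpaces, (7) p.278, (1.3)–(1.6) p.77; Balaban1988Convergent, (2.1) p.254, (2.28) p.259] -/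
def suppOfRecord₁₃SepCoPChi (θ : Stage13Params F N) (χ : ChiSlot F N) (p : B12.RunParams) (n : ℕ)
    (s : SeqOfRecord F θ.ν θ.τ9.M (gOfRecord₁₃Chi F N θ χ p) p.K n) : Set (B15DeterminingSets.MSField (F.P p.K) (SU N)) :=
  {W | W ∈ suppOfRecord₁₃PChi F N θ χ p n s ∧ Sect2.SeqSeparated θ.ν.M₁ s ∧ Sect2.DataSmall7PTop (avOfRecord F N p.K) s.Ω (suppDomOfRecord F θ.ν p.K s.Ω) n (fun j => θ.s2.cR * epsOfRecord θ.ν (gOfRecord₁₃Chi F N θ χ p) j) W}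

/-- Membership in the separated (7)-regular support, read off (`Iff.rfl`). [cite: Balaban1988Convergent, (2.28) p.259 (bookkeeping)] -/
theorem mem_suppOfRecord₁₃SepCoP_iff_chi (θ : Stage13Params F N) (χ : ChiSlot F N) (p : B12.RunParams) (n : ℕ)
    (s : SeqOfRecord F θ.ν θ.τ9.M (gOfRecord₁₃Chi F N θ χ p) p.K n) (W : B15DeterminingSets.MSField (F.P p.K) (SU N)) :
    W ∈ suppOfRecord₁₃SepCoPChi F N θ χ p n s ↔
      W ∈ suppOfRecord₁₃PChi F N θ χ p n s ∧ Sect2.SeqSeparated θ.ν.M₁ s ∧ Sect2.DataSmall7PTop (avOfRecord F N p.K) s.Ω (suppDomOfRecord F θ.ν p.K s.Ω) n (fun j => θ.s2.cR * epsOfRecord θ.ν (gOfRecord₁₃Chi F N θ χ p) j) W :=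
  Iff.rfl

/-- **THE DISPLAYED PROVISOS at `θ : Stage13HParams`, Stage 13, ROW P11 ON PRINT'S SEQUENCES AND PRINT'S (7)-REGULAR DATA, AT THE Co-CLASS BACKGROUND OF RECORD,
OVER THE HISTORY-INDEXED RESIDUAL 𝐓-WEIGHT SLOT** (v1.7 `H` — the successor of v1.4∕v1.5's `Provisos₁₃SepCoP` under director-ym LINE №183 H1ʰ, FINDING №9 (over LINE №169 H1, FINDING №8)): the rows of
`Provisos₁₃SepCoP` VERBATIM — same field names, same order, the θ-level letters `hM` ([III] p. 245 «M = L^m») and `hM₁` (H1 «M₁ ∣ M») included, row `bg` UNCHANGED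
(def-R's ranged background proviso `BgProvisoΛ` over the separated (7)-regular support `suppOfRecord₁₃SepCoPChi` AT the Co-class background `UbgOfRecord₁₃CoPChi`, both
CITED from FILE 24T ∕ 23 at `θ.toStage13Params` — neither reads the residual 𝐓-weight slot) — except that v1.6's two rows on the RUN-INDEXED slot `zrLaws ∕ zrLocal` are
REPLACED by `zhLaws : ∀ (p : B12.RunParams) (n : ℕ) (Ω Λ : ℕ → Set (Site (F.P p.K) 0)), (θ.Zh p n Ω Λ).Laws` ∕ `zhLocal : ∀ (p : B12.RunParams) (n : ℕ) (Ω Λ : ℕ → Set (Site (F.P p.K) 0)), (θ.Zh p n Ω Λ).LocalLaws` on the HISTORY-INDEXED slot `θ.Zh`.  `.toCore` projects to the bg-free core `Provisos₁₃CoPHChi`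
(FILE 27); there is NO row map from or to `Provisos₁₃SepCoPR` ∕ `…SepCoP` (their `zr` ∕ `zt` rows speak of other slots) except the history-blind door `Provisos₁₃SepCoPR.ofHistoryBlind` (§H2).  Rows `intPiece` ∕ `measω` ∕ `measChi` ∕ `rstep` remain THEOREMS of
(H-U) and the ζ-laws (RECORD 13 §4c); the comparability of thresholds and the monotonicity of the history are NOT displayed here.  HYPOTHESES, never admissibility
clauses, never asserted. [cite: Balaban1988Convergent, (1.11) p.248, (2.1) p.254, (2.7) p.255, p.256, (2.18) p.257, (2.21) p.258, (2.28) p.259, (3.2)–(3.9) pp.265–266, (3.16) p.268, (3.20)–(3.21) p.269; Balaban1985RegularSpaces, (1.3)–(1.9) pp.76–77, (7) p.278; Balaban1985Variational, Thm 1 + (5)–(6) p.20] -/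
structure Stage13HParams.Provisos₁₃SepCoPHChi (θ : Stage13HParams F N) (χ : ChiSlot F N) : Prop where
  /-- the level-`k` pieces `χ_k(s)·slot_k(s)` of `ρ_k` are integrable, `k < K`, along the ₁₃ histories -/
  intPiece : ∀ (p : B12.RunParams) (k : ℕ), k < p.K → ∀ s : SeqOfRecord F θ.ν θ.τ9.M (gOfRecord₁₃Chi F N θ.toStage13Params χ p) p.K k,
    Integrable (fun U => chiSeqOfRecord F N θ.ν θ.τ9.M (gOfRecord₁₃Chi F N θ.toStage13Params χ p) p.K k s U *
      slotsOfRecord F N θ.ν θ.τ9 (EOfRecord₁₃Chi F N θ.toStage13Params χ) (wOfRecord₉ F N θ.toStage9Params) θ.ppSel p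
        (gOfRecord₁₃Chi F N θ.toStage13Params χ p) k s U) (fieldMeasure (F.P p.K) k (SU N))
  /-- (O4): the label weights `ω = a·b·ζ` are jointly measurable in `(V′, U)`, `k < K`, along the ₁₃ histories -/
  measω : ∀ (p : B12.RunParams) (k : ℕ), k < p.K → ∀ (s : SeqOfRecord F θ.ν θ.τ9.M (gOfRecord₁₃Chi F N θ.toStage13Params χ p) p.K k)
    (t : LbOfRecord F θ.ν p (gOfRecord₁₃Chi F N θ.toStage13Params χ p) k),
    Measurable (fun z : GaugeField (F.P p.K) (k + 1) (SU N) × GaugeField (F.P p.K) k (SU N) =>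
      ωOfRecord F N θ.ν θ.τ9.M p (gOfRecord₁₃Chi F N θ.toStage13Params χ p) k θ.A₁ θ.ζ s t z.2 z.1)
  /-- the new front factors `χ_{k+1}(s′)` are measurable, `k < K`, along the ₁₃ histories -/
  measChi : ∀ (p : B12.RunParams) (k : ℕ), k < p.K → ∀ s' : SeqOfRecord F θ.ν θ.τ9.M (gOfRecord₁₃Chi F N θ.toStage13Params χ p) p.K (k + 1),
    Measurable (chiSeqOfRecord F N θ.ν θ.τ9.M (gOfRecord₁₃Chi F N θ.toStage13Params χ p) p.K (k + 1) s')
  /-- the residual `ζ` resolves unity -/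
  zetaUnity : IsZetaUnity F N θ.ν θ.τ9.M θ.ζ
  /-- the residual `ζ` has `Σ |ζ| ≤ 1` -/
  zetaAbs : IsZetaAbsLeOne F N θ.ν θ.τ9.M θ.ζ
  /-- def-R's (0.3) provisos of the pre-𝐑 tower of record, INTEGRABLE FORM (`RepData.ProvisosInt`), at every level `k+1 ≤ K`, along the ₁₃ histories, at
  every instance -/
  rstep : ∀ (p : B12.RunParams) (k : ℕ) [DecidableEq (PBond (F.P p.K) (k + 1))], k < p.K →
    (towerRepOfRecord F N θ.ν θ.τ9 (slotsTOfRecord F N θ.ν θ.τ9 (EOfRecord₁₃Chi F N θ.toStage13Params χ) (wOfRecord₉ F N θ.toStage9Params) θ.ppSel)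
      θ.ppSel p (gOfRecord₁₃Chi F N θ.toStage13Params χ p) (k + 1)).toRepData.ProvisosInt
  /-- 11c's laws of the residual §2 data -/
  rzLaws : ∀ K, (θ.Rz K).Laws
  /-- (v1.7 · HISTORY-INDEXED, FINDING №9) 12a's law of the residual part of the 𝐓-weights OF THE RUN AT EVERY STEP ALONG EVERY HISTORY: `ζ0 ≥ 0` -/
  zhLaws : ∀ (p : B12.RunParams) (n : ℕ) (Ω Λ : ℕ → Set (Site (F.P p.K) 0)), (θ.Zh p n Ω Λ).Laws
  /-- (v1.7 · HISTORY-INDEXED) the locality law of the residual 𝐓-weight factor OF THE RUN AT EVERY STEP ALONG EVERY HISTORY -/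
  zhLocal : ∀ (p : B12.RunParams) (n : ℕ) (Ω Λ : ℕ → Set (Site (F.P p.K) 0)), (θ.Zh p n Ω Λ).LocalLaws
  /-- [III] p. 245 «M = L^m is sufficiently large»: the 𝐑-operation cube side `M` is a POWER OF `L` (θ-level letter of print; tribunal J
  TRIB-J-Q1 2026-08-27: with `Odd L` it excludes `4 ∣ M`, under which `PartCompat₁₃Chi θ p n` fails for every `n ≥ 1` and row `bg` idles) -/
  hM : ∃ a : ℕ, θ.τ9.M = F.L ^ a
  /-- [III] p. 245 «M₁ = L^{m₁}, M₂ = L^{m₂}, M₁ < M₂ < M» read as the DIVISIBILITY letter H1 of HYP-AUDIT-13 (director-ym №145 (F2)): the layer width `M₁`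
  of the (2.13) determining sets divides the 𝐑-cube side `M`, hence every 𝐃_j-cube side `L^j·M·R_j` — so `Ω_j`, `Λ_j ∈ 𝐃_j` are unions of the
  `M₁L^jη`-blocks of [15] (1) ∕ [6] (1.4) (θ-level, run-free; `M₁_dvd_dCubeSide`) -/
  hM₁ : θ.ν.M₁ ∣ θ.τ9.M
  /-- p. 259, ON PRINT'S RANGES AND PRINT'S SEQUENCES (v1.4): the Co-CLASS background of record
  `UbgOfRecord₁₃CoPChi` (def-R `UbgMSCoPOfRecord` at the positive levels; director-ym №149 (3)) lies in `U^c_j(X, α_{0,j}, α_{1,j})` for the domains `X ⊂ Λ_j(s)` of the (2.26)–(2.27) ∕ (2.30) sums and in `Ũ^c_j(X)` for the domains of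
  the (2.41)(i) range, on the regular retained configurations AT SEPARATED (2.18) indices `s` ([6] (1.3)–(1.6)) — every run whose ₁₃ history stays in
  the window `]0, γ]` up to the length `n ≤ K` AND whose 𝐃_j-partitions, `1 ≤ j ≤ n`, are compatible with the torus ([III] p. 257; `PartCompat₁₃Chi`, plan WORD-T2) -/
  bg : ∀ (p : B12.RunParams) (n : ℕ), n ≤ p.K → Step.InInterval θ.γ n (gOfRecord₁₃Chi F N θ.toStage13Params χ p) → PartCompat₁₃Chi F N θ.toStage13Params χ p n →
    BgProvisoΛ F N p.K (settingOfRecord₁₃Chi F N θ.toStage13Params χ p) (θ.Rz p.K) θ.τ9.M n (suppOfRecord₁₃SepCoPChi F N θ.toStage13Params χ p n) (UbgOfRecord₁₃CoPChi F N θ.toStage13Params χ p n)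
  /-- **(H-ζ) ROW** (v1.8 · director-ym №228 LOCATED-ζ · plan g87 S2-FULL): the residual fluctuation factor `ζ` of the record is jointly
  measurable in the old and new fields — the displayed bookkeeping proviso `ZetaMeasurable` (RECORD 12 measurability), until v1.7 threaded
  as a separate hypothesis `hζ`, now a ROW of every Stage-13 proviso edition.  A REAL, REQUIRED field (readers: `h.zetaMeas`); the `autoParam`
  default below only FILLS it at a construction site that omits it — from a Stage-13 proviso value of ANY edition already in hand (the
  transports ∕ doors) or from an `hζ` in context (the from-scratch selectors) — and fails loudly with the goal displayed otherwise.
  HYPOTHESIS, never an admissibility clause, never asserted. [cite: Balaban1988Convergent, (3.16) p.268, (3.20)–(3.21) p.269 (bookkeeping)] -/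
  zetaMeas : ZetaMeasurable F N θ.ζ
variable {F N}

/-- The separated-range provisos PROJECT to the core (drop `bg`). [cite: Balaban1988Convergent, (2.18) p.257 (bookkeeping)] -/
theorem Stage13HParams.Provisos₁₃SepCoPHChi.toCore {θ : Stage13HParams F N} {χ : ChiSlot F N} (h : θ.Provisos₁₃SepCoPHChi F N χ) : θ.Provisos₁₃CoPHChi F N χ where
  intPiece := h.intPiece
  measω := h.measω
  measChi := h.measChi
  zetaUnity := h.zetaUnity
  zetaAbs := h.zetaAbs
  rstep := fun p k _ hk => h.rstep p k hk
  rzLaws := h.rzLaws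
  zhLaws := h.zhLaws
  zhLocal := h.zhLocal
  zetaMeas := h.zetaMeas

/-- (v1.4 pin, as v1.3; tribunal J TRIB-J-Q1 ∕ director-ym №145 (F3)) **`M` IS ODD**: `M = L^a` with `L` odd (`T4Family.hL`).  [cite: Balaban1988Convergent, p.245 (bookkeeping)] -/
theorem Stage13HParams.Provisos₁₃SepCoPHChi.odd_M {θ : Stage13HParams F N} {χ : ChiSlot F N} (h : θ.Provisos₁₃SepCoPHChi F N χ) : Odd θ.τ9.M := by
  obtain ⟨a, ha⟩ := h.hM
  rw [ha]
  exact F.hL.1.pow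

/-- (v1.4 pin, as v1.3; director-ym №145 (F3)) **THE ANTI-DODGE CERTIFICATE `¬ 4 ∣ M`**: the junk numerics `M := 4` under which `PartCompat₁₃Chi θ p n` fails for every
`n ≥ 1` (so that row `bg` idles; vet ym-vet-20289, Summits-side `…/Negative/PartCompatDodge.lean`) carry NO v1.3 proviso set — the hypothesis `4 ∣ M` of
that dodge contradicts the field `hM`. [cite: Balaban1988Convergent, p.245, p.257 (bookkeeping)] -/
theorem Stage13HParams.Provisos₁₃SepCoPHChi.not_four_dvd_M {θ : Stage13HParams F N} {χ : ChiSlot F N} (h : θ.Provisos₁₃SepCoPHChi F N χ) : ¬ 4 ∣ θ.τ9.M := fun h4 =>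
  (Nat.not_even_iff_odd.mpr h.odd_M) (even_iff_two_dvd.mpr (dvd_trans (by norm_num : (2 : ℕ) ∣ 4) h4))

/-- (v1.4 pin, as v1.3; director-ym №145 (F2)) **H1 AT EVERY 𝐃_j-CUBE**: `M₁ ∣ L^j·M·R_j` = `dCubeSide L M R_j j` for every `L`, `R_j`, `j` — the (2.13) layers tile
the 𝐃_j-cubes ([15] (1) ∕ [6] (1.4) «Ω_j a union of M₁L^jη-blocks»). [cite: Balaban1985RegularSpaces, (1) p.277; Balaban1988Convergent, (2.1) p.254, (2.13) p.256 (bookkeeping)] -/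
theorem Stage13HParams.Provisos₁₃SepCoPHChi.M₁_dvd_dCubeSide {θ : Stage13HParams F N} {χ : ChiSlot F N} (h : θ.Provisos₁₃SepCoPHChi F N χ) (L R j : ℕ) :
    θ.ν.M₁ ∣ dCubeSide L θ.τ9.M R j :=
  (Dvd.dvd.mul_left h.hM₁ (L ^ j)).mul_right R

/-- (v1.7 `H` · v1.4 SEPARATED (7)-REGULAR RANGE · Co-CLASS BACKGROUND) The weight laws of the run FOR EVERY HISTORY, FROM the provisos (row `zhLaws`). [cite: Balaban1988Convergent, (2.21) p.258 (bookkeeping)] -/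
theorem Stage13HParams.Provisos₁₃SepCoPHChi.wtLaws {θ : Stage13HParams F N} {χ : ChiSlot F N} (h : θ.Provisos₁₃SepCoPHChi F N χ) (p : B12.RunParams) {n : ℕ}
    (s : SeqOfRecord F θ.ν θ.τ9.M (gOfRecord₁₃Chi F N θ.toStage13Params χ p) p.K n) : (WtOfRecord₁₃HChi F N θ χ p s).Laws :=
  WtOfRecord₁₃H_laws_chi h.zhLaws p s

/-- (v1.7 `H` · v1.4 SEPARATED (7)-REGULAR RANGE · Co-CLASS BACKGROUND) **def-T's step provisos FROM the Stage-13 provisos** at every step `k < K` (as FILE 10's `Provisos₁₀.tstep`, along the ₁₃ histories).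
[cite: Balaban1988Convergent, (3.2)–(3.9) pp.265–266, (3.16) p.268, (3.24)–(3.25) p.270] -/
theorem Stage13HParams.Provisos₁₃SepCoPHChi.tstep {θ : Stage13HParams F N} {χ : ChiSlot F N} (h : θ.Provisos₁₃SepCoPHChi F N χ) (p : B12.RunParams) (k : ℕ) (hk : k < p.K) :
    TStepProvisos F N θ.ν θ.τ9 (EOfRecord₁₃Chi F N θ.toStage13Params χ) (wOfRecord₉ F N θ.toStage9Params) θ.ppSel p
      (gOfRecord₁₃Chi F N θ.toStage13Params χ p) k where
  intPiece := h.intPiece p k hk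
  measW := fun s' => measurable_wOfRecord F N θ.ν θ.τ9.M θ.A₁ θ.ζ p (gOfRecord₁₃Chi F N θ.toStage13Params χ p) k (h.measω p k hk) s'
  absW_le := fun s' U V' => abs_wOfRecord_le_one F N θ.ν θ.τ9.M θ.A₁ h.zetaAbs p (gOfRecord₁₃Chi F N θ.toStage13Params χ p) k s' U V'
  measChi := h.measChi p k hk
  unity := isStepUnity_wOfRecord F N θ.ν θ.τ9.M θ.A₁ h.zetaUnity p (gOfRecord₁₃Chi F N θ.toStage13Params χ p) k
variable (F N)

/-! ### §11b (H). The tower and the datum of record keyed on `Provisos₁₃SepCoPHChi`; faces; [V] Thm 1 induction; the record predicate `IsRecordOfRecord₁₃CSepCoPHChi` and its refinement `.toCoPH` -/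

open Classical in
/-- (v1.7 `H` · v1.4 SEPARATED (7)-REGULAR RANGE · Co-CLASS BACKGROUND) **THE TOWER OF RECORD at `θ` under its Stage-13 provisos**, BY HAND at the Stage-13 core (`RGMachineCore.Tower`'s five fields): `ρ := densOfRecord₁₃Chi`,
`Trho := tdensOfRecord₁₃Chi`; the Wilson start by `rhoZero_coreOfRecord₁₃CoPH_chi`; the push-forward obligation by def-T's `isRT_trhoOfRecord9` under the step provisos;
(0.4) at the step by `integral_densOfRecord₁₃_succ_chi` under the INTEGRABLE-FORM `rstep` (at the classical instance). [cite: Balaban1988Convergent, (0.2) p.244, (2.18) p.257, (3.25) p.270; Balaban1989LargeFieldI, (0.4) p.176] -/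
def towerOfRecord₁₃SepCoPHChi (θ : Stage13HParams F N) (χ : ChiSlot F N) (h : θ.Provisos₁₃SepCoPHChi F N χ) : (coreOfRecord₁₃CoPHChi F N θ χ).Tower (avOfRecord F N) where
  ρ := fun p k => densOfRecord₁₃Chi F N θ.toStage13Params χ p k
  Trho := fun p k => tdensOfRecord₁₃Chi F N θ.toStage13Params χ p k
  rho_zero := fun p => (rhoZero_coreOfRecord₁₃CoPH_chi F N θ χ p).symm
  isRT_Trho := fun p k hk => isRT_trhoOfRecord9 F N θ.ν θ.τ9 (EOfRecord₁₃Chi F N θ.toStage13Params χ) (wOfRecord₉ F N θ.toStage9Params) θ.ppSel p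
    (gOfRecord₁₃Chi F N θ.toStage13Params χ p) k hk (h.tstep p k hk)
  integral_succ := fun p k hk => integral_densOfRecord₁₃_succ_chi F N θ.toStage13Params χ p k (h.rstep p k hk)

/-- (v1.7 `H` · v1.4 SEPARATED (7)-REGULAR RANGE · Co-CLASS BACKGROUND) **THE DATUM OF RECORD, STAGE 13**. [cite: Balaban1989LargeFieldII, Thm 1 + (0.1) pp.355–356; Balaban1988Convergent, (0.2) p.244] -/
def datumOfRecord₁₃SepCoPHChi (θ : Stage13HParams F N) (χ : ChiSlot F N) (h : θ.Provisos₁₃SepCoPHChi F N χ) : FiniteEpsData F (SU N) :=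
  datumOfTower F N (coreOfRecord₁₃CoPHChi F N θ χ) (towerOfRecord₁₃SepCoPHChi F N θ χ h)

/-- BRIDGE (`rfl`, proof irrelevance): the separated-range tower IS the core-keyed tower at `h.toCore`. [cite: Balaban1988Convergent, (0.2) p.244 (bookkeeping)] -/
theorem towerOfRecord₁₃SepCoPH_eq_coPH_chi (θ : Stage13HParams F N) (χ : ChiSlot F N) (h : θ.Provisos₁₃SepCoPHChi F N χ) :
    towerOfRecord₁₃SepCoPHChi F N θ χ h = towerOfRecord₁₃CoPHChi F N θ χ h.toCore := rfl

/-- BRIDGE (`rfl`): the separated-range datum IS the core-keyed datum at `h.toCore`. [cite: Balaban1989LargeFieldII, Thm 1 + (0.1) pp.355–356 (bookkeeping)] -/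
theorem datumOfRecord₁₃SepCoPH_eq_coPH_chi (θ : Stage13HParams F N) (χ : ChiSlot F N) (h : θ.Provisos₁₃SepCoPHChi F N χ) :
    datumOfRecord₁₃SepCoPHChi F N θ χ h = datumOfRecord₁₃CoPHChi F N θ χ h.toCore := rfl

/-- (v1.7 `H` · v1.4 SEPARATED (7)-REGULAR RANGE · Co-CLASS BACKGROUND) The tower's densities ARE `densOfRecord₁₃Chi` (`rfl`). [cite: Balaban1988Convergent, (2.18) p.257 (bookkeeping)] -/
theorem towerOfRecord₁₃SepCoPH_ρ_chi (θ : Stage13HParams F N) (χ : ChiSlot F N) (h : θ.Provisos₁₃SepCoPHChi F N χ) (p : B12.RunParams) (k : ℕ) :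
    (towerOfRecord₁₃SepCoPHChi F N θ χ h).ρ p k = densOfRecord₁₃Chi F N θ.toStage13Params χ p k := rfl

/-- (v1.7 `H` · v1.4 SEPARATED (7)-REGULAR RANGE · Co-CLASS BACKGROUND) The tower's `𝐓ρ_k` ARE `tdensOfRecord₁₃Chi` (`rfl`). [cite: Balaban1988Convergent, (3.25) p.270 (bookkeeping)] -/
theorem towerOfRecord₁₃SepCoPH_Trho_chi (θ : Stage13HParams F N) (χ : ChiSlot F N) (h : θ.Provisos₁₃SepCoPHChi F N χ) (p : B12.RunParams) (k : ℕ) :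
    (towerOfRecord₁₃SepCoPHChi F N θ χ h).Trho p k = tdensOfRecord₁₃Chi F N θ.toStage13Params χ p k := rfl

/-- (v1.7 `H` · v1.4 SEPARATED (7)-REGULAR RANGE · Co-CLASS BACKGROUND) `ρ₀` of the tower is integrable on every run: `e^{−E(p)}` times the Wilson–Boltzmann weight (`Missing.integrable_boltzmann`). [cite: Balaban1988Convergent, Thm 1 p.262 (bookkeeping)] -/
theorem integrable_towerOfRecord₁₃SepCoPH_ρ_zero_chi (θ : Stage13HParams F N) (χ : ChiSlot F N) (h : θ.Provisos₁₃SepCoPHChi F N χ) (p : B12.RunParams) :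
    Integrable ((towerOfRecord₁₃SepCoPHChi F N θ χ h).ρ p 0) (fieldMeasure (F.P p.K) 0 (SU N)) := by
  rw [(towerOfRecord₁₃SepCoPHChi F N θ χ h).rho_zero p]
  exact (Missing.integrable_boltzmann RegularGaugeGroup.measurable_reTr (F.P p.K) (sq_nonneg _)).const_mul _

open Classical in
/-- (v1.7 `H` · v1.4 SEPARATED (7)-REGULAR RANGE · Co-CLASS BACKGROUND) `ρ_{k+1}` of the tower is integrable, `k < K`: the (0.3)-density of the R-stepped pre-𝐑 slot under the integrable-form `rstep` (def-R's
`integrable_densityOfSlice_rstepSlotOfRecord_of_provisosInt`). [cite: Balaban1989LargeFieldI, (0.3)–(0.4) p.176 (bookkeeping)] -/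
theorem integrable_towerOfRecord₁₃SepCoPH_ρ_succ_chi (θ : Stage13HParams F N) (χ : ChiSlot F N) (h : θ.Provisos₁₃SepCoPHChi F N χ) (p : B12.RunParams) (k : ℕ) (hk : k < p.K) :
    Integrable ((towerOfRecord₁₃SepCoPHChi F N θ χ h).ρ p (k + 1)) (fieldMeasure (F.P p.K) (k + 1) (SU N)) := by
  rw [towerOfRecord₁₃SepCoPH_ρ_chi, densOfRecord₁₃_succ_chi]
  exact integrable_densityOfSlice_rstepSlotOfRecord_of_provisosInt F N θ.ν θ.τ9 _ θ.ppSel p _ (k + 1) (h.rstep p k hk)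

/-- (v1.7 `H` · v1.4 SEPARATED (7)-REGULAR RANGE · Co-CLASS BACKGROUND) **THE TOWER OF RECORD IS INTEGRABLE** (`RGMachineCore.Tower.IsIntegrable`): every `ρ_k`, `k ≤ K`, from the displayed provisos alone. [cite: Balaban1988Convergent, (0.2) p.244 (bookkeeping)] -/
theorem isIntegrable_towerOfRecord₁₃SepCoPH_chi (θ : Stage13HParams F N) (χ : ChiSlot F N) (h : θ.Provisos₁₃SepCoPHChi F N χ) : (towerOfRecord₁₃SepCoPHChi F N θ χ h).IsIntegrable
  | p, 0, _ => integrable_towerOfRecord₁₃SepCoPH_ρ_zero_chi F N θ χ h p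
  | p, k + 1, hk => integrable_towerOfRecord₁₃SepCoPH_ρ_succ_chi F N θ χ h p k (Nat.lt_of_succ_le hk)

/-- (v1.7 `H` · v1.4 SEPARATED (7)-REGULAR RANGE · Co-CLASS BACKGROUND) … and every `𝐓ρ_k`, `k < K`, is integrable (def-T's `integrable_piece_trhoOfRecord9` summed). [cite: Balaban1988Convergent, (3.25) p.270 (bookkeeping)] -/
theorem integrable_towerOfRecord₁₃SepCoPH_Trho_chi (θ : Stage13HParams F N) (χ : ChiSlot F N) (h : θ.Provisos₁₃SepCoPHChi F N χ) (p : B12.RunParams) (k : ℕ) (hk : k < p.K) :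
    Integrable ((towerOfRecord₁₃SepCoPHChi F N θ χ h).Trho p k) (fieldMeasure (F.P p.K) (k + 1) (SU N)) :=
  integrable_finsetSum Finset.univ (fun s' _ => integrable_piece_trhoOfRecord9 F N θ.ν θ.τ9 (EOfRecord₁₃Chi F N θ.toStage13Params χ) (wOfRecord₉ F N θ.toStage9Params)
    θ.ppSel p (gOfRecord₁₃Chi F N θ.toStage13Params χ p) k hk (h.tstep p k hk) s')

/-- (v1.7 `H` · v1.4 SEPARATED (7)-REGULAR RANGE · Co-CLASS BACKGROUND) FACE `dens` (`rfl`). [cite: Balaban1988Convergent, (2.18) p.257 (bookkeeping)] -/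
theorem dens_datumOfRecord₁₃SepCoPH_chi (θ : Stage13HParams F N) (χ : ChiSlot F N) (h : θ.Provisos₁₃SepCoPHChi F N χ) (K : ℕ) (g₀ : ℝ) (k : ℕ) :
    (datumOfRecord₁₃SepCoPHChi F N θ χ h).dens K g₀ k = densOfRecord₁₃Chi F N θ.toStage13Params χ ⟨K, F.m, g₀⟩ k := rfl

/-- (v1.7 `H` · v1.4 SEPARATED (7)-REGULAR RANGE · Co-CLASS BACKGROUND) FACE `Trho` (`rfl`). [cite: Balaban1988Convergent, (3.25) p.270 (bookkeeping)] -/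
theorem trho_datumOfRecord₁₃SepCoPH_chi (θ : Stage13HParams F N) (χ : ChiSlot F N) (h : θ.Provisos₁₃SepCoPHChi F N χ) (K : ℕ) (g₀ : ℝ) (k : ℕ) :
    (datumOfRecord₁₃SepCoPHChi F N θ χ h).real.Trho K g₀ k = tdensOfRecord₁₃Chi F N θ.toStage13Params χ ⟨K, F.m, g₀⟩ k := rfl

/-- (v1.7 `H` · v1.4 SEPARATED (7)-REGULAR RANGE · Co-CLASS BACKGROUND) FACE `𝐑` (`rfl`). [cite: Balaban1989LargeFieldI, (0.2)–(0.3) p.176 (bookkeeping)] -/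
theorem R_datumOfRecord₁₃SepCoPH_eq_VOfRecord₁₃CoPH_chi (θ : Stage13HParams F N) (χ : ChiSlot F N) (h : θ.Provisos₁₃SepCoPHChi F N χ) (K : ℕ) (g₀ : ℝ) (k : ℕ) :
    (datumOfRecord₁₃SepCoPHChi F N θ χ h).real.R K g₀ k = (VOfRecord₁₃CoPHChi F N θ χ ⟨K, F.m, g₀⟩).R k := rfl

/-- (v1.7 `H` · v1.4 SEPARATED (7)-REGULAR RANGE · Co-CLASS BACKGROUND) … and maps `𝐓ρ_k ↦ ρ_{k+1}`. [cite: Balaban1988Convergent, (0.2) p.244; Balaban1989LargeFieldI, (0.3) p.176] -/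
theorem R_tdens_datumOfRecord₁₃SepCoPH_chi (θ : Stage13HParams F N) (χ : ChiSlot F N) (h : θ.Provisos₁₃SepCoPHChi F N χ) (K : ℕ) (g₀ : ℝ) (k : ℕ) :
    (datumOfRecord₁₃SepCoPHChi F N θ χ h).real.R K g₀ k (tdensOfRecord₁₃Chi F N θ.toStage13Params χ ⟨K, F.m, g₀⟩ k) =
      densOfRecord₁₃Chi F N θ.toStage13Params χ ⟨K, F.m, g₀⟩ (k + 1) :=
  (towerOfRecord₁₃SepCoPHChi F N θ χ h).inducedR_Trho ⟨K, F.m, g₀⟩ k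

/-- (v1.7 `H` · v1.4 SEPARATED (7)-REGULAR RANGE · Co-CLASS BACKGROUND) FACE construction (`rfl`). [cite: Balaban1989LargeFieldII, Thm 1 + (0.1) pp.355–356 (bookkeeping)] -/
theorem datumOfRecord₁₃SepCoPH_C_chi (θ : Stage13HParams F N) (χ : ChiSlot F N) (h : θ.Provisos₁₃SepCoPHChi F N χ) :
    (datumOfRecord₁₃SepCoPHChi F N θ χ h).C = (coreOfRecord₁₃CoPHChi F N θ χ).construction (densOfRecord₁₃Chi F N θ.toStage13Params χ) := rfl

/-- (v1.7 `H` · v1.4 SEPARATED (7)-REGULAR RANGE · Co-CLASS BACKGROUND) FACE β: the datum's β-functions ARE `betaOfRecord₁₃ θ` (`rfl`). [cite: Balaban1987RG1, (1.20)–(1.22) p.264 (bookkeeping)] -/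
theorem βfun_datumOfRecord₁₃SepCoPH_chi (θ : Stage13HParams F N) (χ : ChiSlot F N) (h : θ.Provisos₁₃SepCoPHChi F N χ) :
    (datumOfRecord₁₃SepCoPHChi F N θ χ h).βfun = betaOfRecord₁₃Chi F N θ.toStage13Params χ := rfl

/-- (v1.7 `H` · v1.4 SEPARATED (7)-REGULAR RANGE · Co-CLASS BACKGROUND) … i.e. the χ-generic β at `T := TcanOfRecord`, `χ := chiFixed29 θ.ν θ.ε₂₉` (`rfl`). [cite: Balaban1987RG1, (1.20)–(1.22) p.264, (2.9) p.266 (bookkeeping)] -/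
theorem βfun_datumOfRecord₁₃SepCoPH_eq_betaOfRecord₈Tχ_chi (θ : Stage13HParams F N) (χ : ChiSlot F N) (h : θ.Provisos₁₃SepCoPHChi F N χ) :
    (datumOfRecord₁₃SepCoPHChi F N θ χ h).βfun = betaOfRecord₈Tχ F N (TcanOfRecord F N) χ θ.toStage8Params := rfl

/-- (v1.7 `H` · v1.4 SEPARATED (7)-REGULAR RANGE · Co-CLASS BACKGROUND) FACE flow (`rfl`). [cite: Balaban1987RG1, (0.17)–(0.20) pp.255–256 (bookkeeping)] -/
theorem flow_g_datumOfRecord₁₃SepCoPH_chi (θ : Stage13HParams F N) (χ : ChiSlot F N) (h : θ.Provisos₁₃SepCoPHChi F N χ) (p : B12.RunParams) :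
    ((datumOfRecord₁₃SepCoPHChi F N θ χ h).C p).flow.g = gOfRecord₁₃Chi F N θ.toStage13Params χ p := rfl

/-- (v1.7 `H` · v1.4 SEPARATED (7)-REGULAR RANGE · Co-CLASS BACKGROUND) FACE av (`rfl`). [cite: Balaban1987RG1, (0.4) p.253 (bookkeeping)] -/
theorem av_datumOfRecord₁₃SepCoPH_chi (θ : Stage13HParams F N) (χ : ChiSlot F N) (h : θ.Provisos₁₃SepCoPHChi F N χ) : (datumOfRecord₁₃SepCoPHChi F N θ χ h).av = avOfRecord F N := rfl

/-- (v1.7 `H` · v1.4 SEPARATED (7)-REGULAR RANGE · Co-CLASS BACKGROUND) STAGE-0 DATUM CLAUSE at the Stage-13 datum (`rfl`). [cite: Balaban1987RG1, (0.3)–(0.4) p.253] -/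
theorem isDatumOfRecord₀_datumOfRecord₁₃SepCoPH_chi (θ : Stage13HParams F N) (χ : ChiSlot F N) (h : θ.Provisos₁₃SepCoPHChi F N χ) : IsDatumOfRecord₀ F N (datumOfRecord₁₃SepCoPHChi F N θ χ h) := rfl

/-- (v1.7 `H` · v1.4 SEPARATED (7)-REGULAR RANGE · Co-CLASS BACKGROUND) BINDER B1 = NODE N23 at the Stage-13 datum. [cite: Balaban1987RG1, (0.4) p.253] -/
theorem isPrintedAveraged_datumOfRecord₁₃SepCoPH_chi (θ : Stage13HParams F N) (χ : ChiSlot F N) (h : θ.Provisos₁₃SepCoPHChi F N χ) : (datumOfRecord₁₃SepCoPHChi F N θ χ h).IsPrintedAveraged :=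
  isPrintedAveraged_datumOfTower F N _ _

/-- (v1.7 `H` · v1.4 SEPARATED (7)-REGULAR RANGE · Co-CLASS BACKGROUND) FACE χ ∕ actions ∕ `IndAss` ∕ `Repr`: the Stage-13 core's fields (`rfl`). [cite: Balaban1987RG1, (0.17)–(0.24) pp.255–257 (bookkeeping)] -/
theorem actionSide_stage13SepCoPH_chi (θ : Stage13HParams F N) (χ : ChiSlot F N) (h : θ.Provisos₁₃SepCoPHChi F N χ) (p : B12.RunParams) (k : ℕ) :
    ((datumOfRecord₁₃SepCoPHChi F N θ χ h).C p).χ k = (coreOfRecord₁₃CoPHChi F N θ χ).χ p k ∧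
      ((datumOfRecord₁₃SepCoPHChi F N θ χ h).C p).effAction k = (coreOfRecord₁₃CoPHChi F N θ χ).effAction p k ∧
        ((datumOfRecord₁₃SepCoPHChi F N θ χ h).C p).Ek k = (coreOfRecord₁₃CoPHChi F N θ χ).Ek p k ∧
          (((datumOfRecord₁₃SepCoPHChi F N θ χ h).C p).IndAss k ↔ (coreOfRecord₁₃CoPHChi F N θ χ).IndAss p k) ∧
            (((datumOfRecord₁₃SepCoPHChi F N θ χ h).C p).Repr k ↔ (coreOfRecord₁₃CoPHChi F N θ χ).Repr p k) :=
  ⟨rfl, rfl, rfl, Iff.rfl, Iff.rfl⟩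

/-- (v1.7 `H` · v1.4 SEPARATED (7)-REGULAR RANGE · Co-CLASS BACKGROUND) **FACE `Sect2Form`**: the construction's §2 [III] clause at step `k` IS the repaired §2 form of the post-𝐑 slot family of `ρ_k`, Stage 13.
[cite: Balaban1988Convergent, (2.17)–(2.18) p.257, (2.23)–(2.42) pp.258–261, Thm 1 p.262] -/
theorem sect2Form_stage13SepCoPH_iff_chi (θ : Stage13HParams F N) (χ : ChiSlot F N) (h : θ.Provisos₁₃SepCoPHChi F N χ) (p : B12.RunParams) (k : ℕ) :
    ((datumOfRecord₁₃SepCoPHChi F N θ χ h).C p).Sect2Form k ↔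
      HasSect2FormAEZS F N (FluctV N) p.K (settingOfRecord₁₃Chi F N θ.toStage13Params χ p) k (θ.rzAtChi χ p) (WtOfRecord₁₃HChi F N θ χ p)
        (UbgOfRecord₁₃CoPChi F N θ.toStage13Params χ p k)
        (slotsOfRecord F N θ.ν θ.τ9 (EOfRecord₁₃Chi F N θ.toStage13Params χ) (wOfRecord₉ F N θ.toStage9Params) θ.ppSel p
          (gOfRecord₁₃Chi F N θ.toStage13Params χ p) k) :=
  sLaw₁₃CoPH_iff_chi F N θ χ p k

/-- (v1.7 `H` · v1.4 SEPARATED (7)-REGULAR RANGE · Co-CLASS BACKGROUND) (2.18) holds for the datum's densities with `rep_k` of record, by construction. [cite: Balaban1988Convergent, (2.18) p.257] -/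
theorem holds_dens_datumOfRecord₁₃SepCoPH_chi (θ : Stage13HParams F N) (χ : ChiSlot F N) (h : θ.Provisos₁₃SepCoPHChi F N χ) (K : ℕ) (g₀ : ℝ) (k : ℕ) :
    (reprOfRecord₁₃Chi F N θ.toStage13Params χ ⟨K, F.m, g₀⟩ k).Holds ((datumOfRecord₁₃SepCoPHChi F N θ χ h).dens K g₀ k) :=
  holds_densOfRecord₁₃_chi F N θ.toStage13Params χ _ k

/-- (v1.7 `H` · v1.4 SEPARATED (7)-REGULAR RANGE · Co-CLASS BACKGROUND) FACE Wilson start. [cite: Balaban1988Convergent, Thm 1 p.262] -/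
theorem dens_zero_datumOfRecord₁₃SepCoPH_chi (θ : Stage13HParams F N) (χ : ChiSlot F N) (h : θ.Provisos₁₃SepCoPHChi F N χ) (K : ℕ) (g₀ : ℝ) :
    (datumOfRecord₁₃SepCoPHChi F N θ χ h).dens K g₀ 0 = rhoZeroOfRecord F N K g₀ (EOfRecord₁₃Chi F N θ.toStage13Params χ ⟨K, F.m, g₀⟩) :=
  densOfRecord₁₃_zero_chi F N θ.toStage13Params χ ⟨K, F.m, g₀⟩

/-- (v1.7 `H` · v1.4 SEPARATED (7)-REGULAR RANGE · Co-CLASS BACKGROUND) FACE push-forward: `𝐓ρ_k` IS an averaging-of-record image of `ρ_k` (`k < K`). [cite: Balaban1988Convergent, (3.1) p.264, (3.24)–(3.25) p.270] -/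
theorem isRT_trho_datumOfRecord₁₃SepCoPH_chi (θ : Stage13HParams F N) (χ : ChiSlot F N) (h : θ.Provisos₁₃SepCoPHChi F N χ) (K : ℕ) (g₀ : ℝ) (k : ℕ) (hk : k < K) :
    IsRT (avOfRecord F N K k).avg ((datumOfRecord₁₃SepCoPHChi F N θ χ h).dens K g₀ k) ((datumOfRecord₁₃SepCoPHChi F N θ χ h).real.Trho K g₀ k) :=
  (towerOfRecord₁₃SepCoPHChi F N θ χ h).isRT_Trho ⟨K, F.m, g₀⟩ k hk

/-- (v1.7 `H` · v1.4 SEPARATED (7)-REGULAR RANGE · Co-CLASS BACKGROUND) FACE (0.4) at the step: `∫ρ_{k+1} = ∫𝐓ρ_k` (`k < K`). [cite: Balaban1989LargeFieldI, (0.4) p.176] -/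
theorem integral_dens_succ_datumOfRecord₁₃SepCoPH_chi (θ : Stage13HParams F N) (χ : ChiSlot F N) (h : θ.Provisos₁₃SepCoPHChi F N χ) (K : ℕ) (g₀ : ℝ) (k : ℕ) (hk : k < K) :
    ∫ V, (datumOfRecord₁₃SepCoPHChi F N θ χ h).dens K g₀ (k + 1) V ∂fieldMeasure (F.P K) (k + 1) (SU N)
      = ∫ V, (datumOfRecord₁₃SepCoPHChi F N θ χ h).real.Trho K g₀ k V ∂fieldMeasure (F.P K) (k + 1) (SU N) :=
  (towerOfRecord₁₃SepCoPHChi F N θ χ h).integral_succ ⟨K, F.m, g₀⟩ k hk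

/-- (v1.7 `H` · v1.4 SEPARATED (7)-REGULAR RANGE · Co-CLASS BACKGROUND) `∫ρ_k = ∫ρ₀` along every run, `k ≤ K`. [cite: Balaban1985UV3, (6) p.257] -/
theorem integral_dens_eq_zero_datumOfRecord₁₃SepCoPH_chi (θ : Stage13HParams F N) (χ : ChiSlot F N) (h : θ.Provisos₁₃SepCoPHChi F N χ) (K : ℕ) (g₀ : ℝ) (k : ℕ) (hk : k ≤ K) :
    ∫ V, (datumOfRecord₁₃SepCoPHChi F N θ χ h).dens K g₀ k V ∂fieldMeasure (F.P K) k (SU N)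
      = ∫ U, (datumOfRecord₁₃SepCoPHChi F N θ χ h).dens K g₀ 0 U ∂fieldMeasure (F.P K) 0 (SU N) :=
  (towerOfRecord₁₃SepCoPHChi F N θ χ h).integral_eq_integral_zero ⟨K, F.m, g₀⟩ k hk

/-- (v1.7 `H` · v1.4 SEPARATED (7)-REGULAR RANGE · Co-CLASS BACKGROUND) FACE integrability: every density of the datum, `k ≤ K`, is integrable. [cite: Balaban1988Convergent, (0.2) p.244 (bookkeeping)] -/
theorem integrable_dens_datumOfRecord₁₃SepCoPH_chi (θ : Stage13HParams F N) (χ : ChiSlot F N) (h : θ.Provisos₁₃SepCoPHChi F N χ) (K : ℕ) (g₀ : ℝ) (k : ℕ) (hk : k ≤ K) :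
    Integrable ((datumOfRecord₁₃SepCoPHChi F N θ χ h).dens K g₀ k) (fieldMeasure (F.P K) k (SU N)) :=
  isIntegrable_towerOfRecord₁₃SepCoPH_chi F N θ χ h ⟨K, F.m, g₀⟩ k hk

/-- (v1.7 `H` · v1.4 SEPARATED (7)-REGULAR RANGE · Co-CLASS BACKGROUND) … and so is every realised `𝐓ρ_k`, `k < K`. [cite: Balaban1988Convergent, (3.25) p.270 (bookkeeping)] -/
theorem integrable_trho_datumOfRecord₁₃SepCoPH_chi (θ : Stage13HParams F N) (χ : ChiSlot F N) (h : θ.Provisos₁₃SepCoPHChi F N χ) (K : ℕ) (g₀ : ℝ) (k : ℕ) (hk : k < K) :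
    Integrable ((datumOfRecord₁₃SepCoPHChi F N θ χ h).real.Trho K g₀ k) (fieldMeasure (F.P K) (k + 1) (SU N)) :=
  integrable_towerOfRecord₁₃SepCoPH_Trho_chi F N θ χ h ⟨K, F.m, g₀⟩ k hk

/-- (v1.7 `H` · v1.4 SEPARATED (7)-REGULAR RANGE · Co-CLASS BACKGROUND) The T⁴ apex at the Stage-13 datum, B1 eliminated. [cite: JaffeWittenClay2006, §6.5 p.11] -/
theorem continuumYM4Torus_datumOfRecord₁₃SepCoPH_chi (θ : Stage13HParams F N) (χ : ChiSlot F N) (h : θ.Provisos₁₃SepCoPHChi F N χ)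
    (hB : B16.EndStatementBPrinted (datumOfRecord₁₃SepCoPHChi F N θ χ h).C)
    (hE : EndpointExistence (datumOfRecord₁₃SepCoPHChi F N θ χ h).C.toB12)
    (hNE : T4ApexHybrid.HybridNE7Under (datumOfRecord₁₃SepCoPHChi F N θ χ h) (EndpointExistence (datumOfRecord₁₃SepCoPHChi F N θ χ h).C.toB12)) :
    T4ContinuumYM4Torus.ContinuumYM4Torus (datumOfRecord₁₃SepCoPHChi F N θ χ h) :=
  continuumYM4Torus_datumOfTower F N _ _ hB hE hNE

/-- (v1.7 `H` · v1.4 SEPARATED (7)-REGULAR RANGE · Co-CLASS BACKGROUND) **THE BASE HOLDS** on every run of the Stage-13 datum (`sLaw₁₃CoPH_zero_chi`). [cite: Balaban1988Convergent, Thm 1 p.262; Balaban1989LargeFieldII, Thm 1 p.355 (bookkeeping)] -/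
theorem sect2Form_zero_datumOfRecord₁₃SepCoPH_chi (θ : Stage13HParams F N) (χ : ChiSlot F N) (h : θ.Provisos₁₃SepCoPHChi F N χ) (P : B12.RunParams) :
    ((datumOfRecord₁₃SepCoPHChi F N θ χ h).C P).Sect2Form 0 :=
  (sect2Form_stage13SepCoPH_iff_chi F N θ χ h P 0).mpr ((sLaw₁₃CoPH_iff_chi F N θ χ P 0).mp (sLaw₁₃CoPH_zero_chi F N θ χ P))

/-- (v1.7 `H` · v1.4 SEPARATED (7)-REGULAR RANGE · Co-CLASS BACKGROUND) **`B16.InductionBase` AT THE STAGE-13 DATUM, for every window letter `γ`, NO hypothesis.** [cite: Balaban1988Convergent, Thm 1 p.262; Balaban1989LargeFieldII, Thm 1 p.355 + p.391] -/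
theorem inductionBase_datumOfRecord₁₃SepCoPH_chi (θ : Stage13HParams F N) (χ : ChiSlot F N) (h : θ.Provisos₁₃SepCoPHChi F N χ) (γ : ℝ) : B16.InductionBase (datumOfRecord₁₃SepCoPHChi F N θ χ h).C γ :=
  fun P _ => sect2Form_zero_datumOfRecord₁₃SepCoPH_chi F N θ χ h P

/-- (v1.7 `H` · v1.4 SEPARATED (7)-REGULAR RANGE · Co-CLASS BACKGROUND) **THE STEP OF THEOREM 1 AT THE OBJECTS OF RECORD, Stage 13**: along every run in the `γ`-window, from the 𝐓-STEP LAW «`SLaw₁₃CoPHChi k → TLaw₁₃CoPHChi k`» and the 𝐑-LEAF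
`ROpLeaf (VOfRecord₁₃CoPHChi θ P)`.  Both hypotheses DISPLAYED. [cite: Balaban1989LargeFieldII, Thm 1 p.355 and pp.390–391; Balaban1988Convergent, Thm p.245, Thm 2 p.263] -/
theorem inductionStep_datumOfRecord₁₃SepCoPH_of_tLaw_rOpLeaf_chi (θ : Stage13HParams F N) (χ : ChiSlot F N) (h : θ.Provisos₁₃SepCoPHChi F N χ) (γ : ℝ)
    (hT : ∀ P : B12.RunParams, ((datumOfRecord₁₃SepCoPHChi F N θ χ h).C P).flow.InInterval γ P.K →
      ∀ k, k < P.K → SLaw₁₃CoPHChi F N θ χ P k → TLaw₁₃CoPHChi F N θ χ P k)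
    (hR : ∀ P : B12.RunParams, ((datumOfRecord₁₃SepCoPHChi F N θ χ h).C P).flow.InInterval γ P.K → ROpLeaf (VOfRecord₁₃CoPHChi F N θ χ P)) :
    B16.InductionStep (datumOfRecord₁₃SepCoPHChi F N θ χ h).C γ := by
  intro P hP k hk hS
  have hS' : SLaw₁₃CoPHChi F N θ χ P k := (sLaw₁₃CoPH_iff_chi F N θ χ P k).mpr ((sect2Form_stage13SepCoPH_iff_chi F N θ χ h P k).mp hS)
  exact (sect2Form_stage13SepCoPH_iff_chi F N θ χ h P (k + 1)).mpr
    ((sLaw₁₃CoPH_iff_chi F N θ χ P (k + 1)).mp ((rOpLeaf_VOfRecord₁₃CoPH_iff_chi F N θ χ P).mp (hR P hP) k hk (hT P hP k hk hS')))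

/-- (v1.7 `H` · v1.4 SEPARATED (7)-REGULAR RANGE · Co-CLASS BACKGROUND) **[V] THEOREM 1 AT THE STAGE-13 DATUM FROM ITS PRINTED PIECES WITHOUT A BASE HYPOTHESIS.** [cite: Balaban1989LargeFieldII, Thm 1 p.355 + p.391; Balaban1988Convergent, Thm 1 p.262, Thm p.245, Thm 2 p.263] -/
theorem thm1Printed_datumOfRecord₁₃SepCoPH_of_tLaw_rOpLeaf_chi (θ : Stage13HParams F N) (χ : ChiSlot F N) (h : θ.Provisos₁₃SepCoPHChi F N χ) {γ : ℝ} (hγ : 0 < γ)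
    (hT : ∀ P : B12.RunParams, ((datumOfRecord₁₃SepCoPHChi F N θ χ h).C P).flow.InInterval γ P.K →
      ∀ k, k < P.K → SLaw₁₃CoPHChi F N θ χ P k → TLaw₁₃CoPHChi F N θ χ P k)
    (hR : ∀ P : B12.RunParams, ((datumOfRecord₁₃SepCoPHChi F N θ χ h).C P).flow.InInterval γ P.K → ROpLeaf (VOfRecord₁₃CoPHChi F N θ χ P)) :
    B16.Thm1Printed (datumOfRecord₁₃SepCoPHChi F N θ χ h).C :=
  B16.thm1_of_steps _ γ hγ (inductionBase_datumOfRecord₁₃SepCoPH_chi F N θ χ h γ) (inductionStep_datumOfRecord₁₃SepCoPH_of_tLaw_rOpLeaf_chi F N θ χ h γ hT hR)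

/-- (v1.7 `H` · v1.4 SEPARATED (7)-REGULAR RANGE · Co-CLASS BACKGROUND) **«(D, w) is the record, Stage 13»**: admissible Stage-13 parameters SATISFYING THE STAGE-13 PROVISOS whose Stage-13 datum of record IS `D`, and a world bound
to its construction with a window `0 < w.γ ≤ θ.γ`, Bałaban's block size and the C-binding of record over the Stage-13 view. [cite: Balaban1989LargeFieldII, Thm 1 + (0.1) pp.355–356; Balaban1988Convergent, (0.2) p.244, (2.17)–(2.18) p.257, Thms 1–2 pp.262–263; Balaban1989LargeFieldI, (0.2)–(0.4) p.176; Balaban1987RG1, p.259 (objects of record; bookkeeping)] -/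
def IsRecordOfRecord₁₃CSepCoPHChi (χ : ChiSlot F N) (D : FiniteEpsData F (SU N)) (w : WorldP) : Prop :=
  ∃ (θ : Stage13HParams F N) (h : θ.Provisos₁₃SepCoPHChi F N χ), θ.Admissible F N ∧ D = datumOfRecord₁₃SepCoPHChi F N θ χ h ∧ w.C = D.C ∧ (0 < w.γ ∧ w.γ ≤ θ.γ) ∧
    w.L = (θ.L : ℝ) ∧ ∀ P : B12.RunParams, w.up P = upOfRecord₅C F N (θ.toStage5₁₃CoPHChi F N χ) P

/-- (v1.7 `H` · v1.4 SEPARATED (7)-REGULAR RANGE · Co-CLASS BACKGROUND) **Pointed form**. [cite: Balaban1989LargeFieldII, Thm 1 + (0.1) pp.355–356 (bookkeeping)] -/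
theorem isRecordOfRecord₁₃CSepCoPH_of_eq_chi (θ : Stage13HParams F N) (χ : ChiSlot F N) (h : θ.Provisos₁₃SepCoPHChi F N χ) (hθ : θ.Admissible F N) (w : WorldP)
    (hC : w.C = (datumOfRecord₁₃SepCoPHChi F N θ χ h).C) (hγ : 0 < w.γ ∧ w.γ ≤ θ.γ) (hL : w.L = (θ.L : ℝ))
    (hup : ∀ P, w.up P = upOfRecord₅C F N (θ.toStage5₁₃CoPHChi F N χ) P) :
    IsRecordOfRecord₁₃CSepCoPHChi F N χ (datumOfRecord₁₃SepCoPHChi F N θ χ h) w :=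
  ⟨θ, h, hθ, rfl, hC, hγ, hL, hup⟩

/-- (v1.7 `H` · v1.4 SEPARATED (7)-REGULAR RANGE · Co-CLASS BACKGROUND) **Every admissible Stage-12 parameter satisfying the Stage-13 provisos IS a Stage-13 record at some world**, with any window `0 < γw ≤ θ.γ`.
[cite: Balaban1989LargeFieldII, Thm 1 + (0.1) pp.355–356 (bookkeeping)] -/
theorem exists_world_isRecordOfRecord₁₃CSepCoPH_chi (θ : Stage13HParams F N) (χ : ChiSlot F N) (h : θ.Provisos₁₃SepCoPHChi F N χ) (hθ : θ.Admissible F N) {γw : ℝ} (hγw : 0 < γw ∧ γw ≤ θ.γ) :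
    ∃ w : WorldP, IsRecordOfRecord₁₃CSepCoPHChi F N χ (datumOfRecord₁₃SepCoPHChi F N θ χ h) w ∧ w.γ = γw := by
  obtain ⟨w₀⟩ := nonempty_worldP
  exact ⟨{ w₀ with
      C := (datumOfRecord₁₃SepCoPHChi F N θ χ h).C, γ := γw, L := (θ.L : ℝ), one_lt_L := by exact_mod_cast θ.hL.2,
      up := fun P => upOfRecord₅C F N (θ.toStage5₁₃CoPHChi F N χ) P },
    ⟨θ, h, hθ, rfl, rfl, hγw, rfl, fun _ => rfl⟩, rfl⟩

/-- **THE VERSION SLOT OF THE STAGE-13 RECORD**: a revision of the tower of record `towerOfRecord₁₃SepCoPHChi F N θ χ h` — its level-`k ≥ 1` densities re-chosen within their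
`dV`-a.e. classes, level `0` verbatim.  The v1.7 provisos `Provisos₁₃SepCoPHChi` are UNCHANGED. [cite: Balaban1988Convergent, (2.18) p.257, Cor. 3 (2.50) p.264 (bookkeeping)] -/
abbrev Revision₁₃Chi (θ : Stage13HParams F N) (χ : ChiSlot F N) (h : θ.Provisos₁₃SepCoPHChi F N χ) : Type :=
  TowerRevision (towerOfRecord₁₃SepCoPHChi F N θ χ h)

/-- The trivial revision of the record (the densities of record themselves). [cite: Balaban1988Convergent, (2.18) p.257 (bookkeeping)] -/
def Revision₁₃Chi.refl (θ : Stage13HParams F N) (χ : ChiSlot F N) (h : θ.Provisos₁₃SepCoPHChi F N χ) : Revision₁₃Chi F N θ χ h :=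
  TowerRevision.refl _

/-- (v1.8 `V`) **THE REVISED TOWER OF RECORD at `θ` under its Stage-13 provisos, version `v`**. [cite: Balaban1988Convergent, (0.2) p.244, (2.18) p.257, (3.25) p.270; Balaban1989LargeFieldI, (0.4) p.176 (bookkeeping)] -/
def towerOfRecord₁₃SepCoPHVChi (θ : Stage13HParams F N) (χ : ChiSlot F N) (h : θ.Provisos₁₃SepCoPHChi F N χ) (v : Revision₁₃Chi F N θ χ h) :
    (coreOfRecord₁₃CoPHChi F N θ χ).Tower (avOfRecord F N) :=
  v.tower

/-- (v1.8 `V`) **THE DATUM OF RECORD, STAGE 13, VERSION `v`** — the datum of the core of record over the revised tower. [cite: Balaban1989LargeFieldII, Thm 1 + (0.1) pp.355–356; Balaban1988Convergent, (0.2) p.244 (bookkeeping)] -/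
def datumOfRecord₁₃SepCoPHVChi (θ : Stage13HParams F N) (χ : ChiSlot F N) (h : θ.Provisos₁₃SepCoPHChi F N χ) (v : Revision₁₃Chi F N θ χ h) : FiniteEpsData F (SU N) :=
  datumOfTower F N (coreOfRecord₁₃CoPHChi F N θ χ) (towerOfRecord₁₃SepCoPHVChi F N θ χ h v)

/-- **THE DOOR, tower side** (`rfl`): at the trivial revision the revised tower IS the tower of record. [cite: Balaban1988Convergent, (0.2) p.244 (bookkeeping)] -/
theorem towerOfRecord₁₃SepCoPHV_refl_chi (θ : Stage13HParams F N) (χ : ChiSlot F N) (h : θ.Provisos₁₃SepCoPHChi F N χ) :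
    towerOfRecord₁₃SepCoPHVChi F N θ χ h (Revision₁₃Chi.refl F N θ χ h) = towerOfRecord₁₃SepCoPHChi F N θ χ h := rfl

/-- **THE DOOR** (`rfl`): at the trivial revision the v1.8 datum IS the v1.7 datum of record `datumOfRecord₁₃SepCoPHChi F N θ χ h`. [cite: Balaban1989LargeFieldII, Thm 1 + (0.1) pp.355–356 (bookkeeping)] -/
theorem datumOfRecord₁₃SepCoPHV_refl_chi (θ : Stage13HParams F N) (χ : ChiSlot F N) (h : θ.Provisos₁₃SepCoPHChi F N χ) :
    datumOfRecord₁₃SepCoPHVChi F N θ χ h (Revision₁₃Chi.refl F N θ χ h) = datumOfRecord₁₃SepCoPHChi F N θ χ h := rfl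

section Faces

variable (θ : Stage13HParams F N) (χ : ChiSlot F N) (h : θ.Provisos₁₃SepCoPHChi F N χ) (v : Revision₁₃Chi F N θ χ h)

/-- (v1.8 `V`) FACE av (`rfl`): the averaging of record, every version. [cite: Balaban1987RG1, (0.4) p.253 (bookkeeping)] -/
theorem av_datumOfRecord₁₃SepCoPHV_chi : (datumOfRecord₁₃SepCoPHVChi F N θ χ h v).av = avOfRecord F N := rfl

/-- (v1.8 `V`) STAGE-0 DATUM CLAUSE at the revised datum (`rfl`) — the clause the rung leaf `UV`'s `∃ D` reads. [cite: Balaban1987RG1, (0.3)–(0.4) p.253] -/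
theorem isDatumOfRecord₀_datumOfRecord₁₃SepCoPHV_chi : IsDatumOfRecord₀ F N (datumOfRecord₁₃SepCoPHVChi F N θ χ h v) := rfl

/-- (v1.8 `V`) BINDER B1 = NODE N23 at the revised datum. [cite: Balaban1987RG1, (0.4) p.253] -/
theorem isPrintedAveraged_datumOfRecord₁₃SepCoPHV_chi : (datumOfRecord₁₃SepCoPHVChi F N θ χ h v).IsPrintedAveraged :=
  isPrintedAveraged_datumOfTower F N _ _

/-- (v1.8 `V`) FACE construction (`rfl`): the Stage-13 core's construction over the re-chosen densities. [cite: Balaban1989LargeFieldII, Thm 1 + (0.1) pp.355–356 (bookkeeping)] -/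
theorem datumOfRecord₁₃SepCoPHV_C_chi : (datumOfRecord₁₃SepCoPHVChi F N θ χ h v).C = (coreOfRecord₁₃CoPHChi F N θ χ).construction v.ρ := rfl

/-- (v1.8 `V`) … = the v1.7 construction of record with its `ρ` field UPDATED run by run (`rfl`; the B16-level re-choice shape `{C P with ρ := ρ′ P}`). [cite: Balaban1989LargeFieldII, Thm 1 + (0.1) pp.355–356 (bookkeeping)] -/
theorem datumOfRecord₁₃SepCoPHV_C_eq_update_chi :
    (datumOfRecord₁₃SepCoPHVChi F N θ χ h v).C = fun P => { (datumOfRecord₁₃SepCoPHChi F N θ χ h).C P with ρ := v.ρ P } := rfl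

/-- (v1.8 `V`) FACE `toB12` (`rfl`, EVERY version): the small-field part of the record is version-free — so is `DagBinding.EndpointExistence`. [cite: Balaban1987RG1, Thm 1 p.256 (bookkeeping)] -/
theorem toB12_datumOfRecord₁₃SepCoPHV_chi : (datumOfRecord₁₃SepCoPHVChi F N θ χ h v).C.toB12 = (datumOfRecord₁₃SepCoPHChi F N θ χ h).C.toB12 := rfl

/-- (v1.8 `V`) FACE β (`rfl`): the β-functions of record `betaOfRecord₁₃ θ`, every version. [cite: Balaban1987RG1, (1.20)–(1.22) p.264 (bookkeeping)] -/
theorem βfun_datumOfRecord₁₃SepCoPHV_chi : (datumOfRecord₁₃SepCoPHVChi F N θ χ h v).βfun = betaOfRecord₁₃Chi F N θ.toStage13Params χ := rfl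

/-- (v1.8 `V`) FACE flow (`rfl`): the run's coupling flow is the record's, every version. [cite: Balaban1987RG1, (0.17)–(0.20) pp.255–256 (bookkeeping)] -/
theorem flow_datumOfRecord₁₃SepCoPHV_chi (p : B12.RunParams) :
    ((datumOfRecord₁₃SepCoPHVChi F N θ χ h v).C p).flow = ((datumOfRecord₁₃SepCoPHChi F N θ χ h).C p).flow := rfl

/-- (v1.8 `V`) … so its couplings are `gOfRecord₁₃Chi θ p` (`rfl`). [cite: Balaban1987RG1, (0.17)–(0.20) pp.255–256 (bookkeeping)] -/
theorem flow_g_datumOfRecord₁₃SepCoPHV_chi (p : B12.RunParams) :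
    ((datumOfRecord₁₃SepCoPHVChi F N θ χ h v).C p).flow.g = gOfRecord₁₃Chi F N θ.toStage13Params χ p := rfl

/-- (v1.8 `V`) FACE `dens` (`rfl`): the revised datum's transported densities ARE the re-chosen `v.ρ`. [cite: Balaban1988Convergent, (0.2) p.244 (bookkeeping)] -/
theorem dens_datumOfRecord₁₃SepCoPHV_chi (K : ℕ) (g₀ : ℝ) (k : ℕ) : (datumOfRecord₁₃SepCoPHVChi F N θ χ h v).dens K g₀ k = v.ρ ⟨K, F.m, g₀⟩ k := rfl

/-- (v1.8 `V`) FACE Wilson start: at level `0` the revised datum's density IS the record's (never re-chosen). [cite: Balaban1988Convergent, Thm 1 p.262 (bookkeeping)] -/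
theorem dens_zero_datumOfRecord₁₃SepCoPHV_chi (K : ℕ) (g₀ : ℝ) :
    (datumOfRecord₁₃SepCoPHVChi F N θ χ h v).dens K g₀ 0 = (datumOfRecord₁₃SepCoPHChi F N θ χ h).dens K g₀ 0 :=
  v.rho_zero_eq ⟨K, F.m, g₀⟩

/-- (v1.8 `V`) … and at every level `k ≤ K` it agrees with the record's `dV`-almost everywhere. [cite: Balaban1988Convergent, (0.2) p.244, (2.18) p.257 (bookkeeping)] -/
theorem dens_datumOfRecord₁₃SepCoPHV_ae_chi (K : ℕ) (g₀ : ℝ) (k : ℕ) (hk : k ≤ K) :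
    (datumOfRecord₁₃SepCoPHVChi F N θ χ h v).dens K g₀ k =ᵐ[fieldMeasure (F.P K) k (SU N)] (datumOfRecord₁₃SepCoPHChi F N θ χ h).dens K g₀ k :=
  v.ae_eq ⟨K, F.m, g₀⟩ k hk

/-- (v1.8 `V`) FACE `Trho` (`rfl`): the realised `𝐓ρ_k` are `tdensOfRecord₁₃Chi`, every version. [cite: Balaban1988Convergent, (3.25) p.270 (bookkeeping)] -/
theorem trho_datumOfRecord₁₃SepCoPHV_chi (K : ℕ) (g₀ : ℝ) (k : ℕ) :
    (datumOfRecord₁₃SepCoPHVChi F N θ χ h v).real.Trho K g₀ k = tdensOfRecord₁₃Chi F N θ.toStage13Params χ ⟨K, F.m, g₀⟩ k := rfl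

/-- (v1.8 `V`) FACE `𝐑`: the induced operation maps `𝐓ρ_k ↦` the re-chosen `ρ_{k+1}` — (0.2) holds BY CONSTRUCTION at the revised datum. [cite: Balaban1988Convergent, (0.2) p.244; Balaban1989LargeFieldI, (0.3) p.176 (bookkeeping)] -/
theorem R_tdens_datumOfRecord₁₃SepCoPHV_chi (K : ℕ) (g₀ : ℝ) (k : ℕ) :
    (datumOfRecord₁₃SepCoPHVChi F N θ χ h v).real.R K g₀ k (tdensOfRecord₁₃Chi F N θ.toStage13Params χ ⟨K, F.m, g₀⟩ k) = v.ρ ⟨K, F.m, g₀⟩ (k + 1) :=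
  v.inducedR_tower_Trho ⟨K, F.m, g₀⟩ k

/-- (v1.8 `V`) FACE χ ∕ actions ∕ `IndAss` ∕ `Repr`: the record's, every version (`rfl`). [cite: Balaban1987RG1, (0.17)–(0.24) pp.255–257 (bookkeeping)] -/
theorem actionSide_datumOfRecord₁₃SepCoPHV_chi (p : B12.RunParams) (k : ℕ) :
    ((datumOfRecord₁₃SepCoPHVChi F N θ χ h v).C p).χ k = ((datumOfRecord₁₃SepCoPHChi F N θ χ h).C p).χ k ∧
      ((datumOfRecord₁₃SepCoPHVChi F N θ χ h v).C p).effAction k = ((datumOfRecord₁₃SepCoPHChi F N θ χ h).C p).effAction k ∧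
        ((datumOfRecord₁₃SepCoPHVChi F N θ χ h v).C p).Ek k = ((datumOfRecord₁₃SepCoPHChi F N θ χ h).C p).Ek k ∧
          (((datumOfRecord₁₃SepCoPHVChi F N θ χ h v).C p).IndAss k ↔ ((datumOfRecord₁₃SepCoPHChi F N θ χ h).C p).IndAss k) ∧
            (((datumOfRecord₁₃SepCoPHVChi F N θ χ h v).C p).Repr k ↔ ((datumOfRecord₁₃SepCoPHChi F N θ χ h).C p).Repr k) :=
  ⟨rfl, rfl, rfl, Iff.rfl, Iff.rfl⟩

/-- (v1.8 `V`) FACE `Sect2Form` (`Iff.rfl`): the §2 [III] CLAUSE is the record's at every version (Theorem 1 speaks of θ's represented densities). [cite: Balaban1988Convergent, (2.17)–(2.18) p.257, Thm 1 p.262 (bookkeeping)] -/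
theorem sect2Form_datumOfRecord₁₃SepCoPHV_iff_chi (p : B12.RunParams) (k : ℕ) :
    ((datumOfRecord₁₃SepCoPHVChi F N θ χ h v).C p).Sect2Form k ↔ ((datumOfRecord₁₃SepCoPHChi F N θ χ h).C p).Sect2Form k := Iff.rfl

/-- (v1.8 `V`) **[V] THEOREM 1 IS VERSION-FREE** (`Iff.rfl`): `B16.Thm1Printed` reads `flow` and the `Sect2Form` clause only. [cite: Balaban1989LargeFieldII, Thm 1 p.355 (bookkeeping)] -/
theorem thm1Printed_datumOfRecord₁₃SepCoPHV_iff_chi :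
    B16.Thm1Printed (datumOfRecord₁₃SepCoPHVChi F N θ χ h v).C ↔ B16.Thm1Printed (datumOfRecord₁₃SepCoPHChi F N θ χ h).C := Iff.rfl

/-- (v1.8 `V`) **ENDPOINT EXISTENCE IS VERSION-FREE** (`Iff.rfl`). [cite: Balaban1987RG1, Thm 2 p.259 (bookkeeping)] -/
theorem endpointExistence_datumOfRecord₁₃SepCoPHV_iff_chi :
    EndpointExistence (datumOfRecord₁₃SepCoPHVChi F N θ χ h v).C.toB12 ↔ EndpointExistence (datumOfRecord₁₃SepCoPHChi F N θ χ h).C.toB12 := Iff.rfl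

/-- (v1.8 `V`) FACE tuning (`Iff.rfl`): `FiniteEpsData.Tuned` reads `flow` only. [cite: Balaban1987RG1, Thm 2 p.259 (bookkeeping)] -/
theorem tuned_datumOfRecord₁₃SepCoPHV_iff_chi (γ g : ℝ) (g₀ : ℕ → ℝ) :
    (datumOfRecord₁₃SepCoPHVChi F N θ χ h v).Tuned γ g g₀ ↔ (datumOfRecord₁₃SepCoPHChi F N θ χ h).Tuned γ g g₀ := Iff.rfl

/-- (v1.8 `V`) FACE observables (`rfl`): the averaged loop variables read `av` only. [cite: Balaban1989LargeFieldII, (0.1) p.356 (bookkeeping)] -/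
theorem avgObs_datumOfRecord₁₃SepCoPHV_chi : (datumOfRecord₁₃SepCoPHVChi F N θ χ h v).avgObs = (datumOfRecord₁₃SepCoPHChi F N θ χ h).avgObs := rfl

/-- (v1.8 `V`) FACE scheme (`rfl`): the Wilson scheme of finite-ε expectations is version-free (it reads `F.P`, the bare couplings and `av`). [cite: JaffeWittenClay2006, §6.5 p.11 (bookkeeping)] -/
theorem scheme_datumOfRecord₁₃SepCoPHV_chi (g₀ : ℕ → ℝ) : (datumOfRecord₁₃SepCoPHVChi F N θ χ h v).scheme g₀ = (datumOfRecord₁₃SepCoPHChi F N θ χ h).scheme g₀ := rfl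

/-- (v1.8 `V`) **THE TARGETS' PREFIX AT THE REVISED DATUM** (`Iff.rfl`): ANTECEDENT = (B) pinned at the REVISED datum (ρ-pointwise through Cor. 3), BODY = the record's (version-free). [cite: Balaban1987RG1, Thm 2 p.259 (bookkeeping)] -/
theorem underHypotheses_datumOfRecord₁₃SepCoPHV_iff_chi (Hβ : Prop) (concl : (ℕ → ℝ) → Prop) :
    (datumOfRecord₁₃SepCoPHVChi F N θ χ h v).UnderHypotheses Hβ concl ↔
      (B16.EndStatementBPrinted (datumOfRecord₁₃SepCoPHVChi F N θ χ h v).C → Hβ →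
        ∃ γ₀ : ℝ, 0 < γ₀ ∧ ∀ γ : ℝ, 0 < γ → γ ≤ γ₀ → ∃ g₁ : ℝ, 0 < g₁ ∧ ∀ g : ℝ, 0 < g → g ≤ g₁ →
          ∀ g₀ : ℕ → ℝ, (datumOfRecord₁₃SepCoPHChi F N θ χ h).Tuned γ g g₀ → concl g₀) := Iff.rfl

/-- (v1.8 `V`) **THE HYBRID-NE7 SPINE UNDER A PREFIX AT THE REVISED DATUM** (`Iff.rfl`): `T4ApexHybrid.HybridNE7Under (datumOfRecord₁₃SepCoPHVChi … v) Hβ` IS «(B) at the revised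
datum → `Hβ` → the record's tuned-window body over the record's Wilson schemes» — the body is version-free, the antecedent is not (hence the rung's K3 item is keyed AT the slot). [cite: Balaban1989LargeFieldII, (0.1) p.356; Balaban1987RG1, Thm 2 p.259 (bookkeeping)] -/
theorem hybridNE7Under_datumOfRecord₁₃SepCoPHV_iff_chi (Hβ : Prop) :
    T4ApexHybrid.HybridNE7Under (datumOfRecord₁₃SepCoPHVChi F N θ χ h v) Hβ ↔
      (B16.EndStatementBPrinted (datumOfRecord₁₃SepCoPHVChi F N θ χ h v).C → Hβ →
        ∃ γ₀ : ℝ, 0 < γ₀ ∧ ∀ γ : ℝ, 0 < γ → γ ≤ γ₀ → ∃ g₁ : ℝ, 0 < g₁ ∧ ∀ g : ℝ, 0 < g → g ≤ g₁ →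
          ∀ g₀ : ℕ → ℝ, (datumOfRecord₁₃SepCoPHChi F N θ χ h).Tuned γ g g₀ →
            T4ApexHybrid.StringwiseHybridNE7 ((datumOfRecord₁₃SepCoPHChi F N θ χ h).scheme g₀)) := Iff.rfl

/-- (v1.8 `V`) FACE integrability: every density of the revised datum, `k ≤ K`, is integrable (the record's tower is, `isIntegrable_towerOfRecord₁₃SepCoPH_chi`; `Integrable.congr`). [cite: Balaban1988Convergent, (0.2) p.244 (bookkeeping)] -/
theorem integrable_dens_datumOfRecord₁₃SepCoPHV_chi (K : ℕ) (g₀ : ℝ) (k : ℕ) (hk : k ≤ K) :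
    Integrable ((datumOfRecord₁₃SepCoPHVChi F N θ χ h v).dens K g₀ k) (fieldMeasure (F.P K) k (SU N)) :=
  v.isIntegrable_tower (isIntegrable_towerOfRecord₁₃SepCoPH_chi F N θ χ h) ⟨K, F.m, g₀⟩ k hk

/-- (v1.8 `V`) `∫ρ_k = ∫ρ₀` along every run of the revised datum, `k ≤ K` (`Tower.integral_eq_integral_zero`). [cite: Balaban1985UV3, (6) p.257] -/
theorem integral_dens_eq_zero_datumOfRecord₁₃SepCoPHV_chi (K : ℕ) (g₀ : ℝ) (k : ℕ) (hk : k ≤ K) :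
    ∫ V, (datumOfRecord₁₃SepCoPHVChi F N θ χ h v).dens K g₀ k V ∂fieldMeasure (F.P K) k (SU N)
      = ∫ U, (datumOfRecord₁₃SepCoPHVChi F N θ χ h v).dens K g₀ 0 U ∂fieldMeasure (F.P K) 0 (SU N) :=
  (towerOfRecord₁₃SepCoPHVChi F N θ χ h v).integral_eq_integral_zero ⟨K, F.m, g₀⟩ k hk

/-- (v1.8 `V`) The T⁴ apex at the revised datum, B1 eliminated. [cite: JaffeWittenClay2006, §6.5 p.11] -/
theorem continuumYM4Torus_datumOfRecord₁₃SepCoPHV_chi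
    (hB : B16.EndStatementBPrinted (datumOfRecord₁₃SepCoPHVChi F N θ χ h v).C)
    (hE : EndpointExistence (datumOfRecord₁₃SepCoPHVChi F N θ χ h v).C.toB12)
    (hNE : T4ApexHybrid.HybridNE7Under (datumOfRecord₁₃SepCoPHVChi F N θ χ h v) (EndpointExistence (datumOfRecord₁₃SepCoPHVChi F N θ χ h v).C.toB12)) :
    T4ContinuumYM4Torus.ContinuumYM4Torus (datumOfRecord₁₃SepCoPHVChi F N θ χ h v) :=
  continuumYM4Torus_datumOfTower F N _ _ hB hE hNE

end Faces
/-! ## §R. RECEIPTS at `χ := chiβOfRecord₁₃ θ.toStage13Params` (defs: `rfl`; Prop-structures: field-wise `Iff`) -/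

section ReceiptsSepCoPH
variable {F N}
variable (θ : Stage13HParams F N)

/-- Receipt: the χ-generic separated-range provisos at the record's β-slot are the record's provisos, field for field. [cite: Balaban1988Convergent, (2.18) p.257, (2.28) p.259 (bookkeeping)] -/
theorem provisos₁₃SepCoPHChi_chiβ_iff : θ.Provisos₁₃SepCoPHChi F N (chiβOfRecord₁₃ F N θ.toStage13Params) ↔ θ.Provisos₁₃SepCoPH F N :=
  ⟨fun h => ⟨h.intPiece, h.measω, h.measChi, h.zetaUnity, h.zetaAbs, h.rstep, h.rzLaws, h.zhLaws, h.zhLocal, h.hM, h.hM₁, h.bg, h.zetaMeas⟩,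
   fun h => ⟨h.intPiece, h.measω, h.measChi, h.zetaUnity, h.zetaAbs, h.rstep, h.rzLaws, h.zhLaws, h.zhLocal, h.hM, h.hM₁, h.bg, h.zetaMeas⟩⟩

/-- Receipt: the χ-generic separated-range datum at the record's β-slot IS the record's datum (definitional). [cite: Balaban1989LargeFieldII, Thm 1 + (0.1) pp.355–356 (bookkeeping)] -/
theorem datumOfRecord₁₃SepCoPHChi_chiβ (h : θ.Provisos₁₃SepCoPH F N) :
    datumOfRecord₁₃SepCoPHChi F N θ (chiβOfRecord₁₃ F N θ.toStage13Params) ((provisos₁₃SepCoPHChi_chiβ_iff θ).2 h) = datumOfRecord₁₃SepCoPH F N θ h := rfl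

/-- Receipt: the χ-generic version slot at the record's β-slot IS the record's version slot (definitional equality of types). [cite: Balaban1988Convergent, (2.18) p.257 (bookkeeping)] -/
theorem revision₁₃Chi_chiβ (h : θ.Provisos₁₃SepCoPH F N) :
    Revision₁₃Chi F N θ (chiβOfRecord₁₃ F N θ.toStage13Params) ((provisos₁₃SepCoPHChi_chiβ_iff θ).2 h) = Revision₁₃ F N θ h := rfl

/-- Receipt: the χ-generic revised datum at the record's β-slot IS the record's revised datum (definitional). [cite: Balaban1989LargeFieldII, Thm 1 + (0.1) pp.355–356 (bookkeeping)] -/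
theorem datumOfRecord₁₃SepCoPHVChi_chiβ (h : θ.Provisos₁₃SepCoPH F N) (v : Revision₁₃ F N θ h) :
    datumOfRecord₁₃SepCoPHVChi F N θ (chiβOfRecord₁₃ F N θ.toStage13Params) ((provisos₁₃SepCoPHChi_chiβ_iff θ).2 h) v =
      datumOfRecord₁₃SepCoPHV F N θ h v := rfl

/-- Receipt: the χ-generic partition-compatibility guard at the record's β-slot IS the record's (`Iff.rfl`). [cite: Balaban1988Convergent, (2.1) p.254, p.257 (bookkeeping)] -/
theorem partCompat₁₃Chi_chiβ_iff (θ₀ : Stage13Params F N) (p : B12.RunParams) (n : ℕ) :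
    PartCompat₁₃Chi F N θ₀ (chiβOfRecord₁₃ F N θ₀) p n ↔ PartCompat₁₃ F N θ₀ p n := Iff.rfl

/-- Receipt: the χ-generic support of record at the record's β-slot IS the record's (definitional). [cite: Balaban1988Convergent, (2.10) p.256 (bookkeeping)] -/
theorem suppOfRecord₁₃PChi_chiβ (θ₀ : Stage13Params F N) (p : B12.RunParams) (n : ℕ) :
    suppOfRecord₁₃PChi F N θ₀ (chiβOfRecord₁₃ F N θ₀) p n = suppOfRecord₁₃P F N θ₀ p n := rfl

/-- Receipt: the χ-generic separated (7)-regular support at the record's β-slot IS the record's (definitional). [cite: Balaban1988Convergent, (2.28) p.259 (bookkeeping)] -/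
theorem suppOfRecord₁₃SepCoPChi_chiβ (θ₀ : Stage13Params F N) (p : B12.RunParams) (n : ℕ) :
    suppOfRecord₁₃SepCoPChi F N θ₀ (chiβOfRecord₁₃ F N θ₀) p n = suppOfRecord₁₃SepCoP F N θ₀ p n := rfl

/-- Receipt: the χ-generic Co-class background maps at the record's β-slot ARE the record's (definitional). [cite: Balaban1988Convergent, (2.12)–(2.13) pp.256–257 (bookkeeping)] -/
theorem ubgOfRecord₁₃CoPChi_chiβ (θ₀ : Stage13Params F N) (p : B12.RunParams) (n : ℕ) :
    UbgOfRecord₁₃CoPChi F N θ₀ (chiβOfRecord₁₃ F N θ₀) p n = UbgOfRecord₁₃CoP F N θ₀ p n := rfl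

end ReceiptsSepCoPH

/-! ## §A. THE Ax INSTANCES (`χ := chiβOfRecord₁₃Ax θ`, the cut-off at the AXIAL-GAUGE centre — director-ym №467 (ii) names) and their `rfl` ∕ `Iff.rfl` faces -/

/-- **The separated-range Stage-13 provisos, RE-CENTRED** (`χ := chiβOfRecord₁₃Ax θ`). HYPOTHESES, never asserted. [cite: Balaban1988Convergent, (2.18) p.257, (2.28) p.259, Thm 1 p.262] -/
abbrev Stage13HParams.Provisos₁₃SepCoPHAx (θ : Stage13HParams F N) : Prop :=
  θ.Provisos₁₃SepCoPHChi F N (chiβOfRecord₁₃Ax F N θ.toStage13Params)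

/-- **The separated-range tower of record, RE-CENTRED**. [cite: Balaban1988Convergent, (0.2) p.244, (2.18) p.257, (3.25) p.270] -/
abbrev towerOfRecord₁₃SepCoPHAx (θ : Stage13HParams F N) (h : θ.Provisos₁₃SepCoPHAx F N) :=
  towerOfRecord₁₃SepCoPHChi F N θ (chiβOfRecord₁₃Ax F N θ.toStage13Params) h

/-- **The separated-range datum of record, RE-CENTRED**. [cite: Balaban1989LargeFieldII, Thm 1 + (0.1) pp.355–356] -/
abbrev datumOfRecord₁₃SepCoPHAx (θ : Stage13HParams F N) (h : θ.Provisos₁₃SepCoPHAx F N) : FiniteEpsData F (SU N) :=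
  datumOfRecord₁₃SepCoPHChi F N θ (chiβOfRecord₁₃Ax F N θ.toStage13Params) h

/-- **The version slot of the RE-CENTRED record**. [cite: Balaban1988Convergent, (2.18) p.257, Cor. 3 (2.50) p.264 (bookkeeping)] -/
abbrev Revision₁₃Ax (θ : Stage13HParams F N) (h : θ.Provisos₁₃SepCoPHAx F N) : Type :=
  Revision₁₃Chi F N θ (chiβOfRecord₁₃Ax F N θ.toStage13Params) h

/-- The trivial revision of the RE-CENTRED record. [cite: Balaban1988Convergent, (2.18) p.257 (bookkeeping)] -/
abbrev Revision₁₃Ax.refl (θ : Stage13HParams F N) (h : θ.Provisos₁₃SepCoPHAx F N) : Revision₁₃Ax F N θ h :=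
  Revision₁₃Chi.refl F N θ (chiβOfRecord₁₃Ax F N θ.toStage13Params) h

/-- **THE DATUM OF RECORD, STAGE 13, VERSION `v`, RE-CENTRED** — the carrier the re-cuts K0ᴬ∕K1ᴬ∕K3ᴬ∕27930⁸ read (director-ym №467 (ii)). [cite: Balaban1989LargeFieldII, Thm 1 + (0.1) pp.355–356; Balaban1988Convergent, (2.18) p.257] -/
abbrev datumOfRecord₁₃SepCoPHVAx (θ : Stage13HParams F N) (h : θ.Provisos₁₃SepCoPHAx F N) (v : Revision₁₃Ax F N θ h) : FiniteEpsData F (SU N) :=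
  datumOfRecord₁₃SepCoPHVChi F N θ (chiβOfRecord₁₃Ax F N θ.toStage13Params) h v

section FacesAx
variable (θ : Stage13HParams F N) (h : θ.Provisos₁₃SepCoPHAx F N) (v : Revision₁₃Ax F N θ h)

/-- **THE DOOR, RE-CENTRED** (`rfl`): at the trivial revision the versioned datum IS the re-centred datum of record. [cite: Balaban1989LargeFieldII, Thm 1 + (0.1) pp.355–356 (bookkeeping)] -/
theorem datumOfRecord₁₃SepCoPHVAx_refl : datumOfRecord₁₃SepCoPHVAx F N θ h (Revision₁₃Ax.refl F N θ h) = datumOfRecord₁₃SepCoPHAx F N θ h := rfl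

/-- (Ax) **THE β OF THE RE-CENTRED VERSIONED DATUM IS `betaOfRecord₁₃Ax θ`** — DEFINITIONALLY (director-ym №467 (ii) criterion). [cite: Balaban1987RG1, (1.20)–(1.22) p.264 (bookkeeping)] -/
theorem βfun_datumOfRecord₁₃SepCoPHVAx : (datumOfRecord₁₃SepCoPHVAx F N θ h v).βfun = betaOfRecord₁₃Ax F N θ.toStage13Params := rfl

/-- (Ax) The β of the re-centred datum of record IS `betaOfRecord₁₃Ax θ` (`rfl`). [cite: Balaban1987RG1, (1.20)–(1.22) p.264 (bookkeeping)] -/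
theorem βfun_datumOfRecord₁₃SepCoPHAx : (datumOfRecord₁₃SepCoPHAx F N θ h).βfun = betaOfRecord₁₃Ax F N θ.toStage13Params := rfl

/-- (Ax) FACE `IsDatumOfRecord₀` of the re-centred versioned datum (`rfl` — it reads `av` only). [cite: Balaban1989LargeFieldII, (0.1) p.356 (bookkeeping)] -/
theorem isDatumOfRecord₀_datumOfRecord₁₃SepCoPHVAx : IsDatumOfRecord₀ F N (datumOfRecord₁₃SepCoPHVAx F N θ h v) := rfl

/-- (Ax) FACE averaging of the re-centred versioned datum (`rfl`). [cite: Balaban1989LargeFieldII, (0.1) p.356 (bookkeeping)] -/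
theorem av_datumOfRecord₁₃SepCoPHVAx : (datumOfRecord₁₃SepCoPHVAx F N θ h v).av = avOfRecord F N := rfl

/-- (Ax) **ENDPOINT EXISTENCE IS VERSION-FREE at the re-centred record** (`Iff.rfl`). [cite: Balaban1987RG1, Thm 2 p.259 (bookkeeping)] -/
theorem endpointExistence_datumOfRecord₁₃SepCoPHVAx_iff :
    EndpointExistence (datumOfRecord₁₃SepCoPHVAx F N θ h v).C.toB12 ↔ EndpointExistence (datumOfRecord₁₃SepCoPHAx F N θ h).C.toB12 := Iff.rfl

/-- (Ax) FACE densities of the re-centred versioned datum (`rfl`): the revision's. [cite: Balaban1988Convergent, (2.18) p.257 (bookkeeping)] -/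
theorem dens_datumOfRecord₁₃SepCoPHVAx (K : ℕ) (g₀ : ℝ) (k : ℕ) : (datumOfRecord₁₃SepCoPHVAx F N θ h v).dens K g₀ k = v.ρ ⟨K, F.m, g₀⟩ k := rfl

/-- (Ax) The flow of the re-centred versioned datum solves the RG equation of `betaOfRecord₁₃Ax θ` from `p.g₀` (face of `datumOfTower`). [cite: Balaban1987RG1, (1.20)–(1.22) p.264 (bookkeeping)] -/
theorem flow_g_datumOfRecord₁₃SepCoPHVAx (p : B12.RunParams) :
    ((datumOfRecord₁₃SepCoPHVAx F N θ h v).C p).flow.g = gOfRecord₁₃Chi F N θ.toStage13Params (chiβOfRecord₁₃Ax F N θ.toStage13Params) p := rfl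

end FacesAx

end Literature.MathematicalPhysics.QuantumFieldTheory.Balaban1983to89.Node00

end
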